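import Mathlib
import Literature.NumberTheory.LFunctions.Zhang2022.KnifeEdgeSmoothClassTail

/-!
# The smooth top-vanishing class at ANY length, II: flat discrete means across all lengths (class lemmas)

Second half of `KnifeEdgeSmoothClassTail.lean` (split only for the 400-line rule).  From the pointwise block bound at
the sampled pairs (`KnifeEdgeSmoothClass.tailInvisible_sampled`) and the deterministic flatness inequality
`KnifeEdgeInvisibleTail.abs_sum_mul_norm_sq_perturb_le` (p445477):

* `discMeanFlat_lengths` — p446527 `KnifeEdgeDiscMeanFlat.discMeanFlat` for ANY two lengths `N₁ ≤ N₂` in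
  `[⌈P^{1+ε}⌉, ⌈P^{1+δ}⌉]` and a profile `K`-Lipschitz and bounded by `M` on the overhang region `[1, ∞)` (nothing
  assumed at or below the wall), with the threshold `D₀` UNIFORM in `(g, K, M)`:
  `|discMean(N₂) − discMean(N₁)| ≤ P^{−ε/8}·(discMeanAbs(N₁) + max(K,M)²·discWeight)`;
* `discMeanFlat_topVanishing` — for such a profile vanishing beyond `θ ≤ 1 + δ` (a smooth TOP-VANISHING piece of
  logarithmic length `θ`, any `θ`), the discrete mean of the FULL polynomial (any length `N ≥ ⌈P^{1+ε}⌉`, no upper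
  limit) is within the same bound of the one cut at `⌈P^{1+ε}⌉`, for every `0 < ε < δ`.

The discrete means are written out exactly as in p446527 (no `def`); the displayed HYPOTHESIS `Re ρ = ½` on the sampled
zeros (Zhang's Prop. 2.2 output in the (A)-world) is carried verbatim and never asserted.  WHAT THIS IS NOT: a claim
about Theorems 1–2 of arXiv:2211.02515, about Landau–Siegel zeros, or about Parity; nor the analytic ⇒ calculus bridge
(«the (A)-world off-diagonal of the discrete mean is invisible»), which is not a tree theorem and is not stated here.
[cite: Zhang2022LandauSiegel, §2 (2.14)–(2.20); §8 Lemma 8.1]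
-/

namespace Literature.NumberTheory.LFunctions.Zhang2022.KnifeEdgeSmoothClass

open Finset NNReal
open Literature.NumberTheory.LFunctions.Zhang2022.KnifeEdgeInvisibleTail

section Bookkeeping

open Skeleton

/-- `⌈exp L₀⌉ ≤ D` gives `L₀ ≤ 𝓛 = log D`. [folklore] -/
private theorem le_ell_of_ceil_exp_le' {L₀ : ℝ} {D : ℕ} (hD : ⌈Real.exp L₀⌉₊ ≤ D) : L₀ ≤ ell D := by
  have h : Real.exp L₀ ≤ (D : ℝ) := (Nat.le_ceil _).trans (by exact_mod_cast hD)
  exact (Real.le_log_iff_exp_le (lt_of_lt_of_le (Real.exp_pos _) h)).mpr h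


/-- The coefficient comparison of the flatness step, with the class constant `c`:
`(Ccv³)²/v² + (Ccv³)² ≤ c²v²` for `0 < v ≤ 1`, `2C²v² ≤ 1`. [folklore] -/
private theorem flat_coef {C c v : ℝ} (hv0 : 0 < v) (hv1 : v ≤ 1) (h2C : 2 * C ^ 2 * v ^ 2 ≤ 1) :
    (C * c * v ^ 3) ^ 2 / v ^ 2 + (C * c * v ^ 3) ^ 2 ≤ c ^ 2 * v ^ 2 := by
  have hv2 : 0 < v ^ 2 := pow_pos hv0 2
  have e1 : (C * c * v ^ 3) ^ 2 / v ^ 2 = c ^ 2 * (C ^ 2 * v ^ 4) := by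
    rw [div_eq_iff hv2.ne']; ring
  have e2 : (C * c * v ^ 3) ^ 2 = c ^ 2 * (C ^ 2 * v ^ 6) := by ring
  rw [e1, e2, ← mul_add]
  refine mul_le_mul_of_nonneg_left ?_ (sq_nonneg c)
  have hv4 : v ^ 4 ≤ v ^ 2 := pow_le_pow_of_le_one hv0.le hv1 (by norm_num)
  have hv6 : v ^ 6 ≤ v ^ 4 := pow_le_pow_of_le_one hv0.le hv1 (by norm_num)
  have hC2 : 0 ≤ C ^ 2 := sq_nonneg C
  nlinarith [mul_le_mul_of_nonneg_left hv6 hC2, mul_le_mul_of_nonneg_left hv4 hC2, pow_pos hv0 4]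

/-- `2C²v² ≤ 1` for `v = e^{−ε𝓛⁹/16}` once `𝓛 ≥ 16C²/ε`. [folklore] -/
private theorem two_C_sq_v_sq_le {C ε ℓ : ℝ} (hε : 0 < ε) (hℓ1 : 1 ≤ ℓ) (hℓC : 16 * C ^ 2 / ε ≤ ℓ) :
    2 * C ^ 2 * Real.exp (ℓ ^ 9 * (-(ε / 16))) ^ 2 ≤ 1 := by
  have hℓ9 : ℓ ≤ ℓ ^ 9 := by
    calc ℓ = ℓ ^ 1 := (pow_one _).symm
      _ ≤ ℓ ^ 9 := pow_le_pow_right₀ hℓ1 (by norm_num)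
  have h1 : Real.exp (ℓ ^ 9 * (-(ε / 16))) ^ 2 = Real.exp (-(ℓ ^ 9 * (ε / 8))) := by
    rw [← Real.exp_nat_mul]; congr 1; push_cast; ring
  have h2 : ℓ ^ 9 * (ε / 8) + 1 ≤ Real.exp (ℓ ^ 9 * (ε / 8)) := Real.add_one_le_exp _
  have h3 : 16 * C ^ 2 ≤ ε * ℓ := by rwa [div_le_iff₀' hε] at hℓC
  have h4 : ε * ℓ ≤ ε * ℓ ^ 9 := mul_le_mul_of_nonneg_left hℓ9 hε.le
  have h5 : 2 * C ^ 2 ≤ Real.exp (ℓ ^ 9 * (ε / 8)) := by nlinarith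
  rw [h1, Real.exp_neg, ← div_eq_mul_inv, div_le_one (Real.exp_pos _)]
  exact h5

end Bookkeeping

/-! ## 2. Flatness of the `Re 𝔠*·‖·‖²·Re ω`-weighted discrete mean across all lengths beyond `P^{1+ε}` -/

section Flat

open Skeleton

/-- **Length-flatness of the discrete mean, any two lengths, class constants** (p446527
`KnifeEdgeDiscMeanFlat.discMeanFlat` for general `N₁ ≤ N₂` in `[⌈P^{1+ε}⌉, ⌈P^{1+δ}⌉]` and a profile `K`-Lipschitz
and bounded by `M` on `[1, ∞)`; `0 < ε < δ`; the threshold `D₀` does NOT depend on `g, K, M`): for all large `D` and every primitive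
quadratic `χ (mod D)`, IF every sampled zero has `Re ρ = ½`, then
`|discMean(N₂) − discMean(N₁)| ≤ P^{−ε/8}·(discMeanAbs(N₁) + max(K,M)²·discWeight)`, where
`discMean(N) = Σ_{(ψ,ρ) ∈ idx χ} Re 𝔠*(ρ,ψ)·‖F_N(ψ,ρ)‖²·Re ω(ρ)`, `discMeanAbs` carries `|Re 𝔠* Re ω|` instead,
`discWeight = Σ |Re 𝔠* Re ω|`, `F_N(ψ,ρ) = Σ_{1≤n<N} χψ(n) g(log n/log P) n^{−ρ}` (all written out; no `def`).
Proof: `tailInvisible_sampled` bounds the block by `τ = C·max(K,M)·v³`, `v = P^{−ε/16}`, and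
`abs_sum_mul_norm_sq_perturb_le` with `η = v² = P^{−ε/8}` gives the claim once `2C²v² ≤ 1`.
[cite: Zhang2022LandauSiegel, §2 (2.16)–(2.20); §8 Lemma 8.1] -/
theorem discMeanFlat_lengths (c' : ℝ) {δ ε : ℝ} (hε : 0 < ε) (hεδ : ε < δ) :
    Skeleton.ForAllLarge fun D _ χ =>
      (∀ i ∈ Skeleton.idx χ, (i.2).re = 1 / 2) →
        ∀ (g : ℝ → ℂ) (K : ℝ≥0) (M : ℝ), LipschitzOnWith K g (Set.Ici 1) →
          (∀ z : ℝ, 1 ≤ z → ‖g z‖ ≤ M) →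
          ∀ N₁ N₂ : ℕ, ⌈Skeleton.bigP D ^ (1 + ε)⌉₊ ≤ N₁ → N₁ ≤ N₂ → N₂ ≤ ⌈Skeleton.bigP D ^ (1 + δ)⌉₊ →
            |(∑ i ∈ Skeleton.idx χ, (Skeleton.cstar c' D i.1 i.2).re *
                  ‖∑ n ∈ Finset.Ico 1 N₂,
                      Skeleton.pc χ i.1 n * g (Real.log n / Real.log (Skeleton.bigP D)) * (n : ℂ) ^ (-i.2)‖ ^ 2 *
                    (Skeleton.omegaW D i.2).re) -
                (∑ i ∈ Skeleton.idx χ, (Skeleton.cstar c' D i.1 i.2).re *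
                  ‖∑ n ∈ Finset.Ico 1 N₁,
                      Skeleton.pc χ i.1 n * g (Real.log n / Real.log (Skeleton.bigP D)) * (n : ℂ) ^ (-i.2)‖ ^ 2 *
                    (Skeleton.omegaW D i.2).re)| ≤
              Skeleton.bigP D ^ (-(ε / 8)) *
                ((∑ i ∈ Skeleton.idx χ, |(Skeleton.cstar c' D i.1 i.2).re * (Skeleton.omegaW D i.2).re| *
                    ‖∑ n ∈ Finset.Ico 1 N₁,
                        Skeleton.pc χ i.1 n * g (Real.log n / Real.log (Skeleton.bigP D)) * (n : ℂ) ^ (-i.2)‖ ^ 2) +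
                  max (K : ℝ) M ^ 2 *
                    ∑ i ∈ Skeleton.idx χ, |(Skeleton.cstar c' D i.1 i.2).re * (Skeleton.omegaW D i.2).re|) := by
  have hδ : 0 < δ := by linarith
  obtain ⟨C, hC, D₁, hT⟩ := tailInvisible_sampled hε hδ
  refine ⟨max D₁ ⌈Real.exp (max 1 (16 * C ^ 2 / ε))⌉₊, ?_⟩
  intro D _ χ hD hquad hprim hcrit g K M hg hM N₁ N₂ hN₁ hN₁₂ hN₂
  have hD₁ : D₁ ≤ D := le_trans (le_max_left _ _) hD
  have hT' := hT D χ hD₁ hquad hprim hcrit g K M hg hM N₁ N₂ hN₁ hN₁₂ hN₂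
  -- parameters
  have hℓ : max 1 (16 * C ^ 2 / ε) ≤ ell D := le_ell_of_ceil_exp_le' (le_trans (le_max_right _ _) hD)
  have hℓ1 : 1 ≤ ell D := le_trans (le_max_left _ _) hℓ
  have hℓC : 16 * C ^ 2 / ε ≤ ell D := le_trans (le_max_right _ _) hℓ
  have hP : 0 < bigP D := Real.exp_pos _
  have hNε1 : 1 ≤ ⌈bigP D ^ (1 + ε)⌉₊ := Nat.one_le_ceil_iff.mpr (Real.rpow_pos_of_pos hP _)
  have hN₁1 : 1 ≤ N₁ := le_trans hNε1 hN₁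
  -- `τ = C·c·v³`, `η = v²`, `v = P^{−ε/16}`
  set c : ℝ := max (K : ℝ) M with hcdef
  set v : ℝ := Real.exp (ell D ^ 9 * (-(ε / 16))) with hvdef
  have hv0 : 0 < v := Real.exp_pos _
  have hv1 : v ≤ 1 := by
    rw [hvdef]; apply Real.exp_le_one_iff.mpr
    have : 0 ≤ ell D ^ 9 * (ε / 16) := by positivity
    linarith
  have hPτ : bigP D ^ (-(3 * ε / 16)) = v ^ 3 := by
    rw [bigP, ← Real.exp_mul, hvdef, ← Real.exp_nat_mul]; congr 1; push_cast; ring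
  have hPη : bigP D ^ (-(ε / 8)) = v ^ 2 := by
    rw [bigP, ← Real.exp_mul, hvdef, ← Real.exp_nat_mul]; congr 1; push_cast; ring
  set t : ((_ : Chr D) × ℂ) → ℂ := fun i =>
    ∑ n ∈ Finset.Ico N₁ N₂, Skeleton.pc χ i.1 n * g (Real.log n / Real.log (Skeleton.bigP D)) *
      (n : ℂ) ^ (-i.2) with htdef
  have hτ : ∀ i ∈ Skeleton.idx χ, ‖t i‖ ≤ C * c * v ^ 3 := by
    intro i hi
    have := hT' i hi
    rw [hPτ] at this
    exact this
  -- the long polynomial = the short one + the block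
  have hsplit : ∀ i : ((_ : Chr D) × ℂ),
      (∑ n ∈ Finset.Ico 1 N₂, pc χ i.1 n * g (Real.log n / Real.log (bigP D)) * (n : ℂ) ^ (-i.2)) =
        (∑ n ∈ Finset.Ico 1 N₁, pc χ i.1 n * g (Real.log n / Real.log (bigP D)) * (n : ℂ) ^ (-i.2)) + t i := by
    intro i
    simp only [htdef]
    rw [← Finset.sum_Ico_consecutive _ hN₁1 hN₁₂]
  -- the flatness inequality
  have key := abs_sum_mul_norm_sq_perturb_le (Skeleton.idx χ)
    (fun i : ((_ : Chr D) × ℂ) => (cstar c' D i.1 i.2).re * (omegaW D i.2).re)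
    (fun i : ((_ : Chr D) × ℂ) => ∑ n ∈ Finset.Ico 1 N₁,
      pc χ i.1 n * g (Real.log n / Real.log (bigP D)) * (n : ℂ) ^ (-i.2)) t (pow_pos hv0 2) hτ
  have hdiff : (∑ i ∈ Skeleton.idx χ, (cstar c' D i.1 i.2).re *
        ‖∑ n ∈ Finset.Ico 1 N₂,
            pc χ i.1 n * g (Real.log n / Real.log (bigP D)) * (n : ℂ) ^ (-i.2)‖ ^ 2 * (omegaW D i.2).re) -
      (∑ i ∈ Skeleton.idx χ, (cstar c' D i.1 i.2).re *
        ‖∑ n ∈ Finset.Ico 1 N₁,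
            pc χ i.1 n * g (Real.log n / Real.log (bigP D)) * (n : ℂ) ^ (-i.2)‖ ^ 2 * (omegaW D i.2).re) =
      ∑ i ∈ Skeleton.idx χ, (cstar c' D i.1 i.2).re * (omegaW D i.2).re *
        (‖(∑ n ∈ Finset.Ico 1 N₁,
              pc χ i.1 n * g (Real.log n / Real.log (bigP D)) * (n : ℂ) ^ (-i.2)) + t i‖ ^ 2 -
          ‖∑ n ∈ Finset.Ico 1 N₁,
              pc χ i.1 n * g (Real.log n / Real.log (bigP D)) * (n : ℂ) ^ (-i.2)‖ ^ 2) := by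
    rw [← Finset.sum_sub_distrib]
    refine Finset.sum_congr rfl fun i _ => ?_
    rw [hsplit i]; ring
  rw [hdiff, hPη]
  refine key.trans ?_
  -- coefficients: `(Ccv³)²/v² + (Ccv³)² ≤ c²v²` once `2C²v² ≤ 1`, i.e. `2C² ≤ P^{ε/8}`
  have hW0 : 0 ≤ ∑ i ∈ Skeleton.idx χ, |(cstar c' D i.1 i.2).re * (omegaW D i.2).re| :=
    Finset.sum_nonneg fun _ _ => abs_nonneg _
  have h2C : 2 * C ^ 2 * v ^ 2 ≤ 1 := two_C_sq_v_sq_le hε hℓ1 hℓC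
  have hcoef : (C * c * v ^ 3) ^ 2 / v ^ 2 + (C * c * v ^ 3) ^ 2 ≤ c ^ 2 * v ^ 2 := flat_coef hv0 hv1 h2C
  have hfin := mul_le_mul_of_nonneg_right hcoef hW0
  linarith

/-- **The discrete mean of a smooth TOP-VANISHING piece of any length is that of its cut at `P^{1+ε}`**
(`0 < ε < δ`): for all large `D` and every primitive quadratic `χ (mod D)`, IF every sampled zero has `Re ρ = ½`,
then for every profile `g`, `K`-Lipschitz with `‖g‖ ≤ M` on `[1, ∞)` and VANISHING BEYOND `θ` (`g(z) = 0` for `z ≥ θ`) with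
`θ ≤ 1 + δ`, and EVERY length `N ≥ ⌈P^{1+ε}⌉` (no upper limit: for `N ≥ P^θ` the polynomial is the full one),
`|discMean(N) − discMean(⌈P^{1+ε}⌉)| ≤ P^{−ε/8}·(discMeanAbs(⌈P^{1+ε}⌉) + max(K,M)²·discWeight)`
(notation of `discMeanFlat_lengths`).  So, in the (A)-world, a main term of the normalised discrete mean of a smooth
top-vanishing piece, if it exists, depends only on the piece below `P^{1+ε}`, for every `ε > 0`.
[cite: Zhang2022LandauSiegel, §2 (2.16)–(2.20); §8 Lemma 8.1] -/
theorem discMeanFlat_topVanishing (c' : ℝ) {δ ε : ℝ} (hε : 0 < ε) (hεδ : ε < δ) :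
    Skeleton.ForAllLarge fun D _ χ =>
      (∀ i ∈ Skeleton.idx χ, (i.2).re = 1 / 2) →
        ∀ (g : ℝ → ℂ) (K : ℝ≥0) (M : ℝ), LipschitzOnWith K g (Set.Ici 1) →
          (∀ z : ℝ, 1 ≤ z → ‖g z‖ ≤ M) →
          ∀ θ : ℝ, θ ≤ 1 + δ → (∀ z, θ ≤ z → g z = 0) →
            ∀ N : ℕ, ⌈Skeleton.bigP D ^ (1 + ε)⌉₊ ≤ N →
              |(∑ i ∈ Skeleton.idx χ, (Skeleton.cstar c' D i.1 i.2).re *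
                    ‖∑ n ∈ Finset.Ico 1 N,
                        Skeleton.pc χ i.1 n * g (Real.log n / Real.log (Skeleton.bigP D)) * (n : ℂ) ^ (-i.2)‖ ^ 2 *
                      (Skeleton.omegaW D i.2).re) -
                  (∑ i ∈ Skeleton.idx χ, (Skeleton.cstar c' D i.1 i.2).re *
                    ‖∑ n ∈ Finset.Ico 1 ⌈Skeleton.bigP D ^ (1 + ε)⌉₊,
                        Skeleton.pc χ i.1 n * g (Real.log n / Real.log (Skeleton.bigP D)) * (n : ℂ) ^ (-i.2)‖ ^ 2 *
                      (Skeleton.omegaW D i.2).re)| ≤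
                Skeleton.bigP D ^ (-(ε / 8)) *
                  ((∑ i ∈ Skeleton.idx χ, |(Skeleton.cstar c' D i.1 i.2).re * (Skeleton.omegaW D i.2).re| *
                      ‖∑ n ∈ Finset.Ico 1 ⌈Skeleton.bigP D ^ (1 + ε)⌉₊,
                          Skeleton.pc χ i.1 n * g (Real.log n / Real.log (Skeleton.bigP D)) *
                            (n : ℂ) ^ (-i.2)‖ ^ 2) +
                    max (K : ℝ) M ^ 2 *
                      ∑ i ∈ Skeleton.idx χ, |(Skeleton.cstar c' D i.1 i.2).re * (Skeleton.omegaW D i.2).re|) := by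
  obtain ⟨D₀, h⟩ := discMeanFlat_lengths c' hε hεδ
  refine ⟨max D₀ 3, ?_⟩
  intro D _ χ hD hquad hprim hcrit g K M hg hM θ hθ hg0 N hN
  have h' := h D χ (le_trans (le_max_left _ _) hD) hquad hprim hcrit g K M hg hM
  have hD3 : (3 : ℝ) ≤ D := by exact_mod_cast le_trans (le_max_right _ _) hD
  have hℓ0 : 0 < ell D := Real.log_pos (by linarith)
  have hP : 0 < bigP D := Real.exp_pos _
  have hP1 : 1 ≤ bigP D := by rw [bigP]; exact Real.one_le_exp (by positivity)
  have hlogPpos : 0 < Real.log (bigP D) := by rw [bigP, Real.log_exp]; positivity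
  have hNεδ : ⌈bigP D ^ (1 + ε)⌉₊ ≤ ⌈bigP D ^ (1 + δ)⌉₊ :=
    Nat.ceil_mono (Real.rpow_le_rpow_of_exponent_le hP1 (by linarith))
  by_cases hNle : N ≤ ⌈bigP D ^ (1 + δ)⌉₊
  · exact h' _ N le_rfl hN hNle
  · -- beyond `⌈P^{1+δ}⌉` the polynomial does not change: `g(log n/log P) = 0` there
    have hNδ : ⌈bigP D ^ (1 + δ)⌉₊ ≤ N := (not_le.mp hNle).le
    have hNδ1 : 1 ≤ ⌈bigP D ^ (1 + δ)⌉₊ := Nat.one_le_ceil_iff.mpr (Real.rpow_pos_of_pos hP _)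
    have hpoly : ∀ i : ((_ : Chr D) × ℂ),
        (∑ n ∈ Finset.Ico 1 N, pc χ i.1 n * g (Real.log n / Real.log (bigP D)) * (n : ℂ) ^ (-i.2)) =
          ∑ n ∈ Finset.Ico 1 ⌈bigP D ^ (1 + δ)⌉₊,
            pc χ i.1 n * g (Real.log n / Real.log (bigP D)) * (n : ℂ) ^ (-i.2) := by
      intro i
      rw [← Finset.sum_Ico_consecutive _ hNδ1 hNδ]
      have hzero : ∑ n ∈ Finset.Ico ⌈bigP D ^ (1 + δ)⌉₊ N,
          pc χ i.1 n * g (Real.log n / Real.log (bigP D)) * (n : ℂ) ^ (-i.2) = 0 := by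
        refine Finset.sum_eq_zero fun n hn => ?_
        have hn : ⌈bigP D ^ (1 + δ)⌉₊ ≤ n := (Finset.mem_Ico.mp hn).1
        have hnr : bigP D ^ (1 + δ) ≤ (n : ℝ) := (Nat.le_ceil _).trans (by exact_mod_cast hn)
        have hθn : θ ≤ Real.log n / Real.log (bigP D) := by
          rw [le_div_iff₀ hlogPpos]
          have h1 := Real.log_le_log (Real.rpow_pos_of_pos hP _) hnr
          rw [Real.log_rpow hP] at h1
          calc θ * Real.log (bigP D) ≤ (1 + δ) * Real.log (bigP D) :=
                mul_le_mul_of_nonneg_right hθ hlogPpos.le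
            _ ≤ Real.log n := h1
        rw [hg0 _ hθn]; ring
      rw [hzero, add_zero]
    simp_rw [hpoly]
    exact h' _ _ le_rfl hNεδ le_rfl

end Flat

end Literature.NumberTheory.LFunctions.Zhang2022.KnifeEdgeSmoothClass
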